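import Summits.BirchSwinnertonDyer.BirchSwinnertonDyer.Theorems.CongruentShaFreeCutSelmerRankOneLevelwise
import Summits.BirchSwinnertonDyer.Rank1Residual.GaloisImage.PropagatedConditionCoisotropic
import Summits.BirchSwinnertonDyer.Rank1Residual.GaloisImage.PropagatedConditionCardEP
import Literature.NumberTheory.EllipticCurves.LocalKummerMap
import Literature.NumberTheory.EllipticCurves.WeilPairingProofs
import Literature.NumberTheory.EllipticCurves.PadicPointsFiniteIndexProofs
import Literature.NumberTheory.EllipticCurves.MordellWeilRankZeroProofs
import Mathlib.NumberTheory.Padics.RingHoms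

set_option linter.dupNamespace false
set_option autoImplicit false

/-! # Crux M `ReducibleKatoMember` (stmt-BirchSwinnertonDyer-19196, routes `KatoDescentPotSupersingular` (K9) /
`KatoDescentTamePotSupersingular` (K8-t′)) — LEVELWISE inputs of (R0) «rank zero ∧ `Ш[p^∞]` finite ⇒
`rank_{ℤ_p} H¹(ℤ[1/p], T_pW) ≤ 1» (Kato Thm. 14.5 (1) on the pin, Euler-system-free), part 1 of 2

Cell `bsd-potss`, prover seat `bsd-potss-rkm` g9.  Supports, does not close, stmt-BirchSwinnertonDyer-19196
(the clauses `finite_coinvariants_H2` (Kato Thm. 14.5 (1)) and `index_ne_zero` (Thm. 14.5 (2)) of the held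
input `Kato2004.exists_memberHullInputs`, item 19659, rest on (R0)).  Theorems only (no definition, no named
fact, no `sorry`); route-free.  The rank-ZERO twin of cell `bsd-cn100`'s (R1) files
(`Theorems/CongruentShaFreeCutSelmerRankOneLevelwise.lean`, `…IntegralH1RankLeOne.lean`, p507667/p508547),
whose global skeleton part 2 re-uses verbatim; what is new is the LOCAL input at `p`: in rank one the
relaxed Selmer classes are multiples of one Kummer class (global Poitou–Tate), in rank zero they are
governed by the singular quotient `H¹(ℚ_p, W[p^k])/𝓛_p ≅ 𝓛_p^∨` (LOCAL Tate duality), which is cyclic up to a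
bounded exponent because `E(ℚ_p) ⊇ ℤ_p` with finite index.

## Contents

* §1 (any number field `K`) **`exists_uniform_nsmul_eq_zero_of_mem_selmerGroup`**: if `W(K)` is finite and
  `Ш(W/K)[p^∞]` is finite there is ONE `B ≠ 0` killing `Sel^{(p^k)}(W/K)` for every `k` (Silverman X.4.2:
  `#Ш[p^∞] • d` is a Kummer class `κ(P)`, `P` torsion).
* §2 (over `ℚ`, `v = (p)`) **`exists_local_generator`**: ONE point `P₀ ∈ W(ℚ_v)` and ONE `m ≠ 0` with
  `m • P = ℓ • P₀ + p^j • Q` (`ℓ ∈ ℤ`, `Q ∈ W(ℚ_v)`) for every `P ∈ W(ℚ_v)` and every `j` — Silverman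
  VII.6.3 (`E(ℚ_p) ⊇ A ≅ ℤ_p` of finite index `m`, tree theorem `exists_finiteIndex_addEquiv_padicInt_holds`)
  transported along `ℚ_v ≅ ℚ_p`.
* §3 (any number field `K`, finite place `v`, prime-power level `n`) **the local dichotomy
  `exists_zsmul_sub_mem_kummerSelmerStructure_or`**: if `P₀, m` are as in §2 at level `n` and
  `inv_v : H²(K_v, μₙ) → ℤ/n` is injective, then for any two local classes `c, d ∈ H¹(K_v, W[n])` there is
  `ℓ ∈ ℤ` with `m • (d − ℓ • c) ∈ 𝓛_v` or `m • (c − ℓ • d) ∈ 𝓛_v` (`𝓛_v` the local Kummer condition).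
  Proof: the functional `θ(y) = inv_v(κ_v(P₀) ∪ₑ y) ∈ ℤ/n` (local Weil cup product of a Weil pairing,
  `WeierstrassCurve.exists_weilPairing_holds`); `ℤ/n` is a chain ring for `n` a prime power
  (`exists_intCast_mul_or_of_isPrimePow`), so `θ(d) = ℓ θ(c)` or `θ(c) = ℓ θ(d)`; and `θ(y) = 0 ⇒ m • y ∈ 𝓛_v`
  because `m • 𝓛_v ⊆ ℤ κ_v(P₀)` and `𝓛_v` is its own right annihilator (Tate local duality for `E`, tree
  theorem `GaloisImage.forall_mem_kummerSelmerStructure_weilCupProduct_eq_zero_right_iff_inr_of_localEuler`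
  with the local Euler–Poincaré characteristic DISCHARGED,
  `GaloisImage.EP.localEulerPoincareCharacteristic_adicCompletion`).

HONEST FRAMING: Galois-cohomology bookkeeping over tree theorems; no named fact is introduced; nothing about
Kato's Euler system, the crux, the leaf or BSD is proved here.  PARTITION (D-0054): types-the-object-of two
clauses of held input 19659 of crux M (B5 O6 wild 3 × X3 reducible rows + B4 (t′) X3 rows); closes NONE.

References: [Kato2004Asterisque] Thm. 14.5 (1) (p. 236), §14.9 (14.9.3) (p. 240), 14.13 (p. 243);
[MilneADT2006] I Cor. 2.3, Lemma 3.3, Cor. 3.4, Lemma 6.15; [SilvermanAEC2009] VII.6.3, VIII.§2, X.§4 Thm. X.4.2;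
[PoonenRains2012] Prop. 4.10. -/

noncomputable section

open scoped Classical NumberField

namespace Summit.BirchSwinnertonDyer.BirchSwinnertonDyer.Theorems.IntegralH1RankZero

open CategoryTheory Field IsDedekindDomain NumberField Function
open WeierstrassCurve (geomPoints geomTorsion galH1Torsion selmerLocalKer selmerGroup torsionPoints
  torsionGaloisModule kummerMapTorsion kummerMapTorsion_mem_selmerLocalKer)
open Literature.NumberTheory.GaloisRepresentations Literature.NumberTheory.GaloisCohomology
open Literature.NumberTheory.GaloisRepresentations.DiscreteGaloisModule (mu MuCarrier SelmerStructure)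
open Literature.NumberTheory.EllipticCurves Literature.NumberTheory.EllipticCurves.Kato2004
open Literature.NumberTheory.EllipticCurves.Kato2004.EulerSystemValues
open Summit.BirchSwinnertonDyer.Rank1Residual
open scoped ContRepresentation

/-! ## §1 Rank zero: one exponent kills every `Sel^{(p^k)}(W/K)` -/

section SelmerBound

variable {K : Type} [Field K] [NumberField K] (W : WeierstrassCurve K) [W.IsElliptic] (p : ℕ) [Fact p.Prime]

/-- **Finite `W(K)` and finite `Ш(W/K)[p^∞]`: ONE `B ≠ 0` kills `Sel^{(p^k)}(W/K)` for every `k`.**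
(`B = #Ш[p^∞] · m₀`, `m₀` the exponent of the finite group `W(K)`): for `d ∈ Sel^{(n)}`, `n = p^k`, the image
of `#Ш[p^∞] • d` in `H¹(K, W)` lies in `Ш ∩ H¹(K,W)[n] ⊆ Ш[p^∞]` and is therefore zero, so `#Ш[p^∞] • d` is a
Kummer class `κ(P)` (Silverman X.4.2), and `m₀ • κ(P) = κ(m₀ • P) = 0`.  The rank-zero twin of
`CongruentShaFreeCutSelmerRankOneLevelwise.exists_uniform_nsmul_eq_zsmul_kummerMapTorsion`.
[cite: SilvermanAEC2009, Thm. X.4.2 and VIII.§2] -/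
theorem exists_uniform_nsmul_eq_zero_of_mem_selmerGroup [Finite W.toAffine.Point]
    [Finite (AddCommGroup.primaryComponent W.sha p)] :
    ∃ B : ℕ, B ≠ 0 ∧ ∀ (n : ℤ), (∃ k : ℕ, n = (p : ℤ) ^ k) →
      ∀ d : galH1Torsion W n, d ∈ selmerGroup W n → B • d = 0 := by
  have hp : p.Prime := Fact.out
  haveI : PerfectField K := PerfectField.ofCharZero
  obtain ⟨m₀, hm₀, hm₀t⟩ := exists_nsmul_eq_zero_of_isOfFinAddOrder W
  set s : ℕ := Nat.card (AddCommGroup.primaryComponent W.sha p) with hs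
  have hs0 : s ≠ 0 := Nat.card_pos.ne'
  refine ⟨m₀ * s, Nat.mul_ne_zero hm₀ hs0, fun n ⟨k, hk⟩ d hd => ?_⟩
  have hn0 : n ≠ 0 := by rw [hk]; exact pow_ne_zero k (Int.natCast_ne_zero.mpr hp.ne_zero)
  have hdiv : ∀ P : geomPoints W, ∃ Q : geomPoints W, n • Q = P := fun P =>
    W.zsmul_geomPoints_surjective_holds hn0 P
  -- (i) `s • d` dies in `H¹(K, W)`: its image lies in `Ш ∩ H¹(K,W)[n] ⊆ Ш[p^∞]`
  have himg : WeierstrassCurve.torsionH1ToH1 W _ d ∈ W.sha ⊓ AddSubgroup.torsionBy W.galH1 n := by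
    rw [← W.map_torsionH1ToH1_selmerGroup_holds hn0]
    exact AddSubgroup.mem_map_of_mem _ hd
  have hprim : (⟨WeierstrassCurve.torsionH1ToH1 W _ d, himg.1⟩ : W.sha) ∈
      AddCommGroup.primaryComponent W.sha p := by
    refine (AddCommGroup.mem_primaryComponent).mpr ⟨k, Subtype.ext ?_⟩
    have h2 : n • WeierstrassCurve.torsionH1ToH1 W _ d = 0 := himg.2
    rw [AddSubgroupClass.coe_nsmul, ZeroMemClass.coe_zero, ← natCast_zsmul, Nat.cast_pow, ← hk]
    exact h2
  have hsd : WeierstrassCurve.torsionH1ToH1 W _ (s • d) = 0 := by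
    have h := card_nsmul_eq_zero' (G := AddCommGroup.primaryComponent W.sha p)
      (x := ⟨⟨WeierstrassCurve.torsionH1ToH1 W _ d, himg.1⟩, hprim⟩)
    have h' := congrArg (fun z : AddCommGroup.primaryComponent W.sha p => ((z : W.sha) : W.galH1)) h
    simp only [AddSubgroupClass.coe_nsmul, ZeroMemClass.coe_zero] at h'
    rw [map_nsmul]
    exact h'
  -- (ii) so `s • d = κ_n(P)` with `P` torsion, and `m₀ • κ(P) = 0`
  obtain ⟨P, hP⟩ :=
    WeierstrassCurve.mem_range_kummerMapTorsion_of_torsionH1ToH1_eq_zero W _ hdiv (s • d) hsd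
  have hPt : m₀ • kummerMapTorsion W _ hdiv P = 0 := by
    rw [← map_nsmul, hm₀t P (isOfFinAddOrder_of_finite P), map_zero]
  calc (m₀ * s) • d = m₀ • (s • d) := mul_nsmul' d m₀ s
    _ = m₀ • kummerMapTorsion W _ hdiv P := by rw [hP]
    _ = 0 := hPt

end SelmerBound

/-! ## §2 `W(ℚ_p) ⊇ ℤ_p` of finite index: one generator modulo `p^j` and a uniform exponent -/

section LocalGenerator

variable (W : WeierstrassCurve ℚ) [W.IsElliptic] (p : ℕ) [Fact p.Prime]

/-- **ONE generator of `W(ℚ_v)` modulo `p^j W(ℚ_v)`, up to a uniform exponent** (`v` the place of `ℚ`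
above `p`, `ℚ_v = (primePlace p).adicCompletion ℚ`): there are `P₀ ∈ W(ℚ_v)` and `m ≠ 0` such that every
`P ∈ W(ℚ_v)` satisfies `m • P = ℓ • P₀ + p^j • Q` for some `ℓ ∈ ℤ`, `Q ∈ W(ℚ_v)`, for every `j`.  Indeed
`W(ℚ_p)` has a subgroup `A ≅ ℤ_p` of finite index `m` (Silverman VII.6.3, tree theorem
`exists_finiteIndex_addEquiv_padicInt_holds`, transported along Mathlib's `ℚ_v ≃ ℚ_p`): take `P₀ ↔ 1` and
write `a = ℓ + p^j b` in `ℤ_p` with `ℓ ∈ ℕ` the `j`-th digit approximation.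
[cite: SilvermanAEC2009, Prop. VII.6.3] -/
theorem exists_local_generator :
    ∃ (P₀ : (W.baseChange ((primePlace p).adicCompletion ℚ)).toAffine.Point) (m : ℕ), m ≠ 0 ∧
      ∀ (j : ℕ) (P : (W.baseChange ((primePlace p).adicCompletion ℚ)).toAffine.Point),
        ∃ (ℓ : ℤ) (Q : (W.baseChange ((primePlace p).adicCompletion ℚ)).toAffine.Point),
          m • P = ℓ • P₀ + ((p : ℤ) ^ j) • Q := by
  have hp : p.Prime := Fact.out
  -- transport `W(ℚ_v) ≃+ W(ℚ_p)` along Mathlib's `ℚ_v ≃ₐ[ℚ] ℚ_p`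
  let e : (primePlace p).adicCompletion ℚ ≃ₐ[ℚ] ℚ_[p] :=
    (Padic.adicCompletionEquiv (R := 𝓞 ℚ) ⟨p, Fact.out⟩).toAlgEquiv.symm
  let f : (W.baseChange ((primePlace p).adicCompletion ℚ)).toAffine.Point →+
      (W.baseChange ℚ_[p]).toAffine.Point :=
    WeierstrassCurve.Affine.Point.map (W' := W) (e : (primePlace p).adicCompletion ℚ →ₐ[ℚ] ℚ_[p])
  let g : (W.baseChange ℚ_[p]).toAffine.Point →+
      (W.baseChange ((primePlace p).adicCompletion ℚ)).toAffine.Point :=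
    WeierstrassCurve.Affine.Point.map (W' := W) (e.symm : ℚ_[p] →ₐ[ℚ] (primePlace p).adicCompletion ℚ)
  have hcomp₁ : (e.symm : ℚ_[p] →ₐ[ℚ] (primePlace p).adicCompletion ℚ).comp
      (e : (primePlace p).adicCompletion ℚ →ₐ[ℚ] ℚ_[p]) = AlgHom.id ℚ _ :=
    AlgHom.ext fun x => e.symm_apply_apply x
  have hcomp₂ : (e : (primePlace p).adicCompletion ℚ →ₐ[ℚ] ℚ_[p]).comp
      (e.symm : ℚ_[p] →ₐ[ℚ] (primePlace p).adicCompletion ℚ) = AlgHom.id ℚ _ :=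
    AlgHom.ext fun x => e.apply_symm_apply x
  have hgf : ∀ P, g (f P) = P := fun P => by
    change WeierstrassCurve.Affine.Point.map _ (WeierstrassCurve.Affine.Point.map _ P) = P
    rw [WeierstrassCurve.Affine.Point.map_map, hcomp₁]
    cases P <;> rfl
  have hfg : ∀ Q, f (g Q) = Q := fun Q => by
    change WeierstrassCurve.Affine.Point.map _ (WeierstrassCurve.Affine.Point.map _ Q) = Q
    rw [WeierstrassCurve.Affine.Point.map_map, hcomp₂]
    cases Q <;> rfl
  let F : (W.baseChange ((primePlace p).adicCompletion ℚ)).toAffine.Point ≃+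
      (W.baseChange ℚ_[p]).toAffine.Point :=
    { f with invFun := g, left_inv := hgf, right_inv := hfg }
  haveI : (W.baseChange ℚ_[p]).IsElliptic := by rw [WeierstrassCurve.baseChange]; infer_instance
  obtain ⟨A, hA, ⟨eA⟩⟩ := exists_finiteIndex_addEquiv_of_addEquiv F
    (exists_finiteIndex_addEquiv_padicInt_holds p (W.baseChange ℚ_[p]))
  haveI := hA
  refine ⟨((eA.symm 1 : A) : _), A.index, AddSubgroup.FiniteIndex.index_ne_zero, fun j P => ?_⟩
  set a : ℤ_[p] := eA ⟨A.index • P, A.nsmul_index_mem P⟩ with ha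
  obtain ⟨b, hb⟩ := Ideal.mem_span_singleton'.mp (PadicInt.appr_spec j a)
  -- `a = appr + p^j * b`
  have hab : a = ((PadicInt.appr a j : ℕ) : ℤ_[p]) + (p : ℤ_[p]) ^ j * b := by
    linear_combination (-1 : ℤ_[p]) * hb
  refine ⟨((PadicInt.appr a j : ℕ) : ℤ), ((eA.symm b : A) : _), ?_⟩
  have key : (⟨A.index • P, A.nsmul_index_mem P⟩ : A) =
      (PadicInt.appr a j) • eA.symm 1 + (p ^ j) • eA.symm b := by
    apply eA.injective
    rw [map_add, map_nsmul, map_nsmul, AddEquiv.apply_symm_apply, AddEquiv.apply_symm_apply, ← ha,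
      nsmul_eq_mul, nsmul_eq_mul, mul_one, Nat.cast_pow]
    exact hab
  have key' := congrArg (fun z : A => (z : (W.baseChange ((primePlace p).adicCompletion ℚ)).toAffine.Point)) key
  simp only [AddSubgroup.coe_add, AddSubgroupClass.coe_nsmul] at key'
  rw [key', natCast_zsmul, ← Nat.cast_pow, natCast_zsmul]

end LocalGenerator

/-! ## §3 The local dichotomy at a finite place (local Tate duality for `E`) -/

section Chain

/-- **`ℤ/n` is a chain ring for `n` a prime power**: for `a, b ∈ ℤ/n` there is an integer `ℓ` with
`b = ℓ a` or `a = ℓ b` (lift to `ℤ_q`, where divisibility is total, and reduce). [folklore] -/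
theorem exists_intCast_mul_or_of_isPrimePow {N : ℕ} (hN : IsPrimePow N) (a b : ZMod N) :
    ∃ ℓ : ℤ, b = (ℓ : ZMod N) * a ∨ a = (ℓ : ZMod N) * b := by
  obtain ⟨q, j, hq, hj, rfl⟩ := (isPrimePow_nat_iff N).mp hN
  haveI : Fact q.Prime := ⟨hq⟩
  haveI : NeZero (q ^ j) := ⟨pow_ne_zero _ hq.ne_zero⟩
  have hα : PadicInt.toZModPow j ((a.val : ℕ) : ℤ_[q]) = a := by
    rw [map_natCast, ZMod.natCast_zmod_val]
  have hβ : PadicInt.toZModPow j ((b.val : ℕ) : ℤ_[q]) = b := by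
    rw [map_natCast, ZMod.natCast_zmod_val]
  rcases ValuationRing.dvd_total ((a.val : ℕ) : ℤ_[q]) ((b.val : ℕ) : ℤ_[q]) with ⟨μ, hμ⟩ | ⟨μ, hμ⟩
  · refine ⟨((PadicInt.toZModPow j μ).val : ℤ), Or.inl ?_⟩
    rw [Int.cast_natCast, ZMod.natCast_zmod_val, ← hα, ← hβ, hμ, map_mul, mul_comm]
  · refine ⟨((PadicInt.toZModPow j μ).val : ℤ), Or.inr ?_⟩
    rw [Int.cast_natCast, ZMod.natCast_zmod_val, ← hα, ← hβ, hμ, map_mul, mul_comm]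

end Chain

section Local

variable {K : Type} [Field K] [NumberField K] (W : WeierstrassCurve K) [W.IsElliptic] (n : ℕ) [NeZero n]

/-- **The local dichotomy at a finite place** (local Tate duality for `E`).  Let `v` be a finite place of the
number field `K`, `n` a prime power, `inv_v : H²(K_v, μₙ) → ℤ/n` an injective additive map (e.g. the canonical
local invariant map), and `P₀ ∈ W(K_v)`, `m ∈ ℕ` such that `m • P ∈ ℤ P₀ + n W(K_v)` for every `P ∈ W(K_v)`.
Then for any two local classes `c, d ∈ H¹(K_v, W[n])` there is an integer `ℓ` with `m • (d − ℓ • c) ∈ 𝓛_v`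
or `m • (c − ℓ • d) ∈ 𝓛_v`, `𝓛_v` the local Kummer condition (`kummerSelmerStructure`).  Proof: with a Weil
pairing `e` on `W[n]` (`WeierstrassCurve.exists_weilPairing_holds`) let `θ(y) = inv_v(κ_v(P₀) ∪ₑ y) ∈ ℤ/n`
(`κ_v` the local Kummer map, `∪ₑ` the local Weil cup product `weilContPairingLocal`).  (i) `θ(y) = 0 ⇒
m • y ∈ 𝓛_v`: every `x ∈ 𝓛_v` is `κ_v(P)` (`range_localKummerMap`), `m • x = ℓ' • κ_v(P₀)` (`κ_v(n • Q) = 0`,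
`ker_localKummerMap`), so `x ∪ₑ (m • y) = ℓ' • (κ_v(P₀) ∪ₑ y)` has `inv_v = 0`, hence vanishes, and `𝓛_v` is
its own RIGHT annihilator — Tate local duality for `E`, tree theorem
`GaloisImage.forall_mem_kummerSelmerStructure_weilCupProduct_eq_zero_right_iff_inr_of_localEuler`, whose local
Euler–Poincaré hypothesis is the theorem `GaloisImage.EP.localEulerPoincareCharacteristic_adicCompletion`.
(ii) `ℤ/n` is a chain ring (`exists_intCast_mul_or_of_isPrimePow`), so `θ(d) = ℓ θ(c)` or `θ(c) = ℓ θ(d)`,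
i.e. `θ(d − ℓ • c) = 0` or `θ(c − ℓ • d) = 0`.  This is the rank-zero substitute for "Selmer classes are
multiples of one Kummer class": the singular quotient `H¹(K_v, W[n])/𝓛_v ≅ 𝓛_v^∨` is cyclic up to the
exponent `m`.  (The compactness of `Γ_{K_v}` and the finiteness of `W[n]`, `μₙ` are supplied inside the proof.)
[cite: MilneADT2006, Ch. I, Cor. 2.3, Cor. 3.4 and Lemma 6.15] [cite: SilvermanAEC2009, Prop. VII.6.3 and X.§4 diagram (**)]
[cite: PoonenRains2012, Prop. 4.10] -/
theorem exists_zsmul_sub_mem_kummerSelmerStructure_or (hn : IsPrimePow n) (v : HeightOneSpectrum (𝓞 K))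
    (inv : galoisCohomology ((mu K n).toLocal (Sum.inr v)) 2 →+ ZMod n) (hinv : Injective inv)
    {m : ℕ} (P₀ : (W.baseChange (v.adicCompletion K)).toAffine.Point)
    (hgen : ∀ P : (W.baseChange (v.adicCompletion K)).toAffine.Point,
      ∃ (ℓ : ℤ) (Q : (W.baseChange (v.adicCompletion K)).toAffine.Point), m • P = ℓ • P₀ + (n : ℤ) • Q)
    (c d : galoisCohomology ((W.torsionGaloisModule n).toLocal (Sum.inr v)) 1) :
    ∃ ℓ : ℤ, m • (d - ℓ • c) ∈ W.kummerSelmerStructure n (Sum.inr v) ∨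
      m • (c - ℓ • d) ∈ W.kummerSelmerStructure n (Sum.inr v) := by
  -- cup products need `LocallyCompactSpace Γ_{K_v}`; `W[n]` is finite
  haveI : CompactSpace (absoluteGaloisGroup (Place.Completion (Sum.inr v : Place K))) :=
    absoluteGaloisGroup_compactSpace _
  haveI : Finite (geomTorsion W n) := finite_geomTorsion_of_neZero W n
  haveI : CharZero (v.adicCompletion K) := charZero_adicCompletion v
  haveI : PerfectField K := PerfectField.ofCharZero
  have hnZ : (n : ℤ) ≠ 0 := Int.natCast_ne_zero.mpr (NeZero.ne n)
  -- a Weil pairing at level `n`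
  obtain ⟨q, j, hq, hj, hqj⟩ := (isPrimePow_nat_iff n).mp hn
  have h2n : 2 ≤ n := hqj ▸ Nat.one_lt_pow hj.ne' hq.one_lt
  obtain ⟨e, hμ, hadd₁, hadd₂, halt, hnondeg, hgal⟩ := WeierstrassCurve.exists_weilPairing_holds W n h2n
    (by exact_mod_cast NeZero.ne n)
  -- the local Weil cup product and the local Kummer map, read on `H¹` of the local module at `v`
  let P := weilContPairingLocal W n e hμ hadd₁ hadd₂ hgal (Sum.inr v)
  let κ : (W.baseChange (v.adicCompletion K)).toAffine.Point →+
      galoisCohomology ((W.torsionGaloisModule n).toLocal (Sum.inr v)) 1 :=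
    W.localKummerMap (v.adicCompletion K) hnZ
  have hEP := GaloisImage.EP.localEulerPoincareCharacteristic_adicCompletion K v
  -- (i) `inv (κ P₀ ∪ y) = 0 ⇒ m • y ∈ 𝓛_v`
  have step : ∀ y : galoisCohomology ((W.torsionGaloisModule n).toLocal (Sum.inr v)) 1,
      inv (P.cupProduct (κ P₀) y) = 0 → m • y ∈ W.kummerSelmerStructure n (Sum.inr v) := by
    intro y hy'
    refine (GaloisImage.forall_mem_kummerSelmerStructure_weilCupProduct_eq_zero_right_iff_inr_of_localEuler
      W n e hμ hadd₁ hadd₂ hgal halt hnondeg hn v hEP (m • y)).mp fun x hx => ?_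
    -- `x = κ(Q₁)` for a point `Q₁`
    have hx' : x ∈ (W.localKummerMap (v.adicCompletion K) hnZ).range := by
      rw [W.range_localKummerMap (v.adicCompletion K) hnZ]
      exact hx
    obtain ⟨Q₁, hQ₁⟩ := hx'
    have hxκ : x = κ Q₁ := hQ₁.symm
    obtain ⟨ℓ, Q, hQ⟩ := hgen Q₁
    have hnQ : κ ((n : ℤ) • Q) = 0 := by
      show W.localKummerMap (v.adicCompletion K) hnZ ((n : ℤ) • Q) = 0
      rw [← AddMonoidHom.mem_ker, W.ker_localKummerMap (v.adicCompletion K) hnZ]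
      exact ⟨Q, rfl⟩
    have hm : m • κ Q₁ = ℓ • κ P₀ := by
      rw [← map_nsmul, hQ, map_add, map_zsmul, hnQ, add_zero]
    -- `z ↦ z ∪ y` as an additive map in the FIRST variable (`galoisCohomology` and the `ModuleCat` carrier of
    -- `continuousCohomology` are only definitionally equal, so no `rw` under `∪`: term-mode transports)
    let L : galoisCohomology ((W.torsionGaloisModule n).toLocal (Sum.inr v)) 1 →+
        galoisCohomology ((mu K n).toLocal (Sum.inr v)) 2 :=
      AddMonoidHom.mk' (fun z => P.cupProduct z y) fun z z' => DFunLike.congr_fun (map_add P.cupProduct z z') y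
    have hL : ∀ z, L z = P.cupProduct z y := fun _ => rfl
    have e1 : L (κ Q₁) = P.cupProduct (κ Q₁) y := hL _
    have e2 : P.cupProduct (κ Q₁) (m • y) = m • P.cupProduct (κ Q₁) y := map_nsmul (P.cupProduct (κ Q₁)) m y
    have e3 : L (m • κ Q₁) = m • L (κ Q₁) := map_nsmul L m (κ Q₁)
    have e4 : L (m • κ Q₁) = L (ℓ • κ P₀) := congrArg L hm
    have e5 : L (ℓ • κ P₀) = ℓ • L (κ P₀) := map_zsmul L ℓ (κ P₀)
    -- `κ(Q₁) ∪ (m • y) = (m • κ(Q₁)) ∪ y = ℓ • (κ(P₀) ∪ y)`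
    have h1 : P.cupProduct (κ Q₁) (m • y) = ℓ • L (κ P₀) :=
      e2.trans ((congrArg (fun z => m • z) e1.symm).trans (e3.symm.trans (e4.trans e5)))
    have hy'' : inv (L (κ P₀)) = 0 := hy'
    have h3 : inv (P.cupProduct (κ Q₁) (m • y)) = 0 :=
      (congrArg inv h1).trans ((map_zsmul inv ℓ (L (κ P₀))).trans (by rw [hy'', smul_zero]))
    rw [hxκ]
    exact hinv (h3.trans (map_zero inv).symm)
  -- (ii) the functional `θ = inv (κ P₀ ∪ ·)` takes values in the chain ring `ℤ/n`
  let θ : galoisCohomology ((W.torsionGaloisModule n).toLocal (Sum.inr v)) 1 →+ ZMod n :=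
    inv.comp (P.cupProduct (κ P₀)).toAddMonoidHom
  obtain ⟨ℓ, hℓ | hℓ⟩ := exists_intCast_mul_or_of_isPrimePow hn (θ c) (θ d)
  · refine ⟨ℓ, Or.inl (step _ ?_)⟩
    show θ (d - ℓ • c) = 0
    rw [map_sub, map_zsmul, hℓ, zsmul_eq_mul, sub_self]
  · refine ⟨ℓ, Or.inr (step _ ?_)⟩
    show θ (c - ℓ • d) = 0
    rw [map_sub, map_zsmul, hℓ, zsmul_eq_mul, sub_self]

end Local


end Summit.BirchSwinnertonDyer.BirchSwinnertonDyer.Theorems.IntegralH1RankZero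

end
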